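import Summits.HodgeConjecture.HodgeConjecture.Theorems.Ring2WeilCoverageCMFieldCubicRationalNorms
import Mathlib.RingTheory.Norm.Transitivity
import Mathlib.FieldTheory.Galois.Basic
import HarnessLib

/-!
# Ring 2 — Weil-type family-coverage census, CM-field rows (X-AC): the RATIONAL rows of EVERY table with `[F:ℚ]`
# ODD and `E ⊇ ℚ(√−c₀)` — `[q] = [1] ⟺ q ∈ N_{ℚ(√−c₀)/ℚ}`, uniformly, by the transitivity of the norm

HONEST FRAMING: research route conditional on HC_CM; not a corollary; Q11.4-sentence-2 already refuted in dim ≥ 3.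

Cell `pub-hodge-ring2`, seat `ring2-b03` (gen 59), census `WEIL-FAMILY-COVERAGE.md` «## b03» b03.24. Parts X-AA/X-AB decide
the rational rows `[q]`, `q ∈ ℚ^×`, of the `ℚ(ζ₇)`- and `ℚ(ζ₉)`-tables by an explicit polynomial identity per carrier.
This part proves the UNIFORM statement behind them, on Deligne's carriers `F = realField R = ℚ[S]/(R)`,
`E = cmField R = ℚ[T]/(R(T²))` (`Deligne1982/WeilTypeCMDiscriminant`), for ANY `R`:

* `norm_rat_eq_pow_of_mul_cmConj_eq` — if `z z̄ = c ∈ ℚ` then `N_{E/ℚ}(z) = c^{deg R}`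
  (`N_{E/ℚ} = N_{F/ℚ} ∘ N_{E/F}`, Mathlib `Algebra.norm_norm`, and `N_{E/F}(z) = z z̄`,
  `Deligne1982.algebraMap_norm_eq_mul_cmConj`);
* `exists_norm_rat_eq_sq_add_mul_sq` — if `E` contains `s` with `s̄ = −s`, `s² = −c₀`, `c₀ ∈ ℚ_{>0}` (so
  `K = ℚ(s) ≅ ℚ(√−c₀) ⊆ E`), then `N_{E/ℚ}(z) = x² + c₀y²` for some `x, y ∈ ℚ` (`N_{E/ℚ} = N_{K/ℚ} ∘ N_{E/K}`;
  `K/ℚ` is quadratic, hence Galois with group `{1, ·̄|_K}`, so `N_{K/ℚ}(x + ys) = (x + ys)(x − ys) = x² + c₀y²`);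
* **`mk_eq_splitDiscriminantClassCM_two_iff_of_odd`** — for `deg R = [F:ℚ]` ODD and `t ∈ F` with `σt² = −c₀`
  (`s = tη`): for every `q ∈ ℚ^×`, `[q] = [(−1)²] = [1]` in `F^×/Nm_{E/F}(E^×)` **iff** `q = x² + c₀y²` for some
  `x, y ∈ ℚ` («⟸» part X-Z `mk_eq_splitDiscriminantClassCM_two_of_sq_add_mul_sq`; «⟹» `q^{2m+1} = x² + c₀y²` gives
  `q = (x/q^m)² + c₀(y/q^m)²`). For `[F:ℚ]` EVEN the argument gives nothing (`q^{2m}` is always a norm from `K`) —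
  consistent with the quartic tables of b03.5–b03.22, where the rational rows needed place-by-place arithmetic.

For the census this settles, for EVERY sextic (more generally odd-half-degree) CM field `E ⊇ ℚ(√−c₀)` presented on a
Deligne carrier, the column «split special fibre? (which)» on all RATIONAL rows at once: `W_{2e₀k}.E.[q]` is the
split component iff `q` is a norm from the imaginary quadratic subfield — e.g. the six sextic fields of the b03.23
tables: `ℚ(ζ₇) ⊇ ℚ(√−7)`, `ℚ(ζ₉) ⊇ ℚ(√−3)`, `ℚ(ζ₇)⁺(i)`, `ℚ(ζ₉)⁺(i)`, `F₁₄₈(i) ⊇ ℚ(i)`, `ℚ(ζ₇)⁺(√−3) ⊇ ℚ(√−3)`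
(their tabulated rational classes `[3], [13], [39]`; `[2], [17], [34]`; `[7], [3], [21]`; `[3]`; `[19], [23], [3], [31],
[43], [57]`; `[2]` are exactly the non-norms from `K`). THEOREMS ONLY: no `def`, no named fact, no `sorry`; `HC_CM`
does not occur; nothing about the Hodge conjecture is asserted.

## References
* [Deligne1982HodgeCycles] P. Deligne (notes by J. S. Milne), LNM 900 (1982), §4 p. 30 (1), Cor. 4.2, Lemma 4.6.
* J. Neukirch, *Algebraic Number Theory*, Springer 1999, Ch. I (2.7) (transitivity of the norm) — background.
-/

noncomputable section

set_option linter.dupNamespace false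

open Polynomial

namespace Summit.HodgeConjecture.HodgeConjecture.Ring2.WeilCoverageCM

open Literature.AlgebraicGeometry.Deligne1982
open Literature.AlgebraicGeometry.HodgeTheory (splitDiscriminantClassCM)

section OddDegree

variable {R : Polynomial ℤ} [Fact (Irreducible (realPolyQ R))] [Fact (Irreducible (cmPolyQ R))]

/-- **`N_{E/ℚ}(z) = c^{[F:ℚ]}` when `z z̄ = c ∈ ℚ`**: `N_{E/ℚ}(z) = N_{F/ℚ}(N_{E/F}(z)) = N_{F/ℚ}(c) = c^{deg R}`
(`N_{E/F}(z) = z z̄`, `Deligne1982.algebraMap_norm_eq_mul_cmConj`; transitivity of the norm).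
[cite: Deligne1982HodgeCycles, §4 p. 30] -/
theorem norm_rat_eq_pow_of_mul_cmConj_eq (z : cmField R) (c : ℚ) (hz : z * cmConj R z = (c : cmField R)) :
    Algebra.norm ℚ z = c ^ R.natDegree := by
  haveI := isScalarTower_realField R
  have h1 : Algebra.norm (realField R) z = algebraMap ℚ (realField R) c := by
    apply (algebraMap (realField R) (cmField R)).injective
    rw [algebraMap_norm_eq_mul_cmConj, hz, ← IsScalarTower.algebraMap_apply ℚ (realField R) (cmField R) c]
    exact (eq_ratCast _ _).symm
  rw [← Algebra.norm_norm (S := realField R), h1, Algebra.norm_algebraMap, finrank_realField]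

omit [Fact (Irreducible (realPolyQ R))] in
/-- **`N_{E/ℚ}(E) ⊆ N_{K/ℚ}(K)` for an imaginary quadratic subfield `K = ℚ(s) ⊆ E`, `s̄ = −s`, `s² = −c₀ < 0`:**
`N_{E/ℚ}(z) = x² + c₀y²` for some `x, y ∈ ℚ` (`N_{E/ℚ} = N_{K/ℚ} ∘ N_{E/K}`; `K/ℚ` quadratic, hence Galois with
`Gal = {1, ·̄|_K}`; `N_{E/K}(z) = x + ys` and `N_{K/ℚ}(x + ys) = (x + ys)(x − ys)`). [folklore] -/
theorem exists_norm_rat_eq_sq_add_mul_sq {c₀ : ℚ} (hc₀ : 0 < c₀) (s : cmField R)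
    (hs : s ^ 2 = -(c₀ : cmField R)) (hsc : cmConj R s = -s) (z : cmField R) :
    ∃ x y : ℚ, Algebra.norm ℚ z = x ^ 2 + c₀ * y ^ 2 := by
  classical
  -- the polynomial `X² + c₀` and `s`
  have hmonic : (X ^ 2 + C c₀ : ℚ[X]).Monic := by monicity!
  have hdeg2 : (X ^ 2 + C c₀ : ℚ[X]).natDegree = 2 := by compute_degree!
  have hroot : Polynomial.aeval s (X ^ 2 + C c₀ : ℚ[X]) = 0 := by
    rw [map_add, map_pow, aeval_X, aeval_C, hs, eq_ratCast, neg_add_cancel]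
  have hint : IsIntegral ℚ s := ⟨X ^ 2 + C c₀, hmonic, by rw [← Polynomial.aeval_def]; exact hroot⟩
  have hirr : Irreducible (X ^ 2 + C c₀ : ℚ[X]) := by
    rw [hmonic.irreducible_iff_roots_eq_zero_of_degree_le_three (by rw [hdeg2]) (by rw [hdeg2]; norm_num)]
    refine Multiset.eq_zero_of_forall_notMem fun r hr => ?_
    rw [Polynomial.mem_roots hmonic.ne_zero, Polynomial.IsRoot, eval_add, eval_pow, eval_X, eval_C] at hr
    nlinarith [sq_nonneg r]
  have hmin : minpoly ℚ s = X ^ 2 + C c₀ := (minpoly.eq_of_irreducible_of_monic hirr hroot hmonic).symm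
  have hs0 : s ≠ 0 := by
    intro h0
    rw [h0, zero_pow two_ne_zero, zero_eq_neg, Rat.cast_eq_zero] at hs
    exact hc₀.ne' hs
  -- `K = ℚ(s)`, quadratic, Galois
  set K : IntermediateField ℚ (cmField R) := IntermediateField.adjoin ℚ {s} with hK
  have hsK : s ∈ K := IntermediateField.mem_adjoin_simple_self ℚ s
  haveI : FiniteDimensional ℚ K := IntermediateField.adjoin.finiteDimensional hint
  have hfin : Module.finrank ℚ K = 2 := by
    rw [hK, IntermediateField.adjoin.finrank hint, hmin, hdeg2]
  haveI : Algebra.IsQuadraticExtension ℚ K := { finrank_eq_two' := hfin }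
  -- `u = N_{E/K}(z) ∈ K`, `N_{E/ℚ}(z) = N_{K/ℚ}(u)`
  set u : K := Algebra.norm K z with hu
  have hnn : Algebra.norm ℚ z = Algebra.norm ℚ u := by rw [hu, Algebra.norm_norm]
  -- `u = x + y s`
  obtain ⟨x, y, hxy⟩ : ∃ x y : ℚ, (u : cmField R) = (x : cmField R) + (y : cmField R) * s := by
    have hu' : (u : cmField R) ∈ Algebra.adjoin ℚ {s} := by
      rw [← IntermediateField.adjoin_simple_toSubalgebra_of_isAlgebraic hint.isAlgebraic,
        IntermediateField.mem_toSubalgebra]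
      exact u.2
    rw [Algebra.adjoin_singleton_eq_range_aeval] at hu'
    obtain ⟨p, hp⟩ := hu'
    refine ⟨(p %ₘ (X ^ 2 + C c₀)).coeff 0, (p %ₘ (X ^ 2 + C c₀)).coeff 1, ?_⟩
    have hne1 : (X ^ 2 + C c₀ : ℚ[X]) ≠ 1 := by
      intro h1
      rw [h1, natDegree_one] at hdeg2
      exact absurd hdeg2 (by norm_num)
    have hdlt : (p %ₘ (X ^ 2 + C c₀)).natDegree ≤ 1 := by
      have := Polynomial.natDegree_modByMonic_lt p hmonic hne1
      rw [hdeg2] at this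
      omega
    change (Polynomial.aeval s) p = _ at hp
    rw [← hp, ← Polynomial.aeval_modByMonic_eq_self_of_root (p := p) hroot]
    conv_lhs => rw [Polynomial.eq_X_add_C_of_natDegree_le_one hdlt]
    rw [map_add, map_mul, aeval_C, aeval_X, aeval_C, eq_ratCast (algebraMap ℚ (cmField R)),
      eq_ratCast (algebraMap ℚ (cmField R))]
    ring
  -- `Gal(K/ℚ) = {1, τ}`, `τ` = complex conjugation restricted to `K`
  let τ : K ≃ₐ[ℚ] K := (cmConjEquiv R).restrictNormal K
  have hτ : ∀ k : K, ((τ k : K) : cmField R) = cmConj R (k : cmField R) := fun k =>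
    AlgEquiv.restrictNormal_commutes (cmConjEquiv R) K k
  have hne : τ ≠ 1 := by
    intro h
    have h1 := hτ ⟨s, hsK⟩
    rw [h, AlgEquiv.one_apply] at h1
    change s = cmConj R s at h1
    rw [hsc, eq_neg_iff_add_eq_zero, ← two_mul, mul_eq_zero] at h1
    rcases h1 with h1 | h1
    · exact two_ne_zero h1
    · exact hs0 h1
  have hcard : Fintype.card (K ≃ₐ[ℚ] K) = 2 := by
    rw [← Nat.card_eq_fintype_card, IsGalois.card_aut_eq_finrank, hfin]
  have huniv : (Finset.univ : Finset (K ≃ₐ[ℚ] K)) = {1, τ} := by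
    symm
    apply Finset.eq_univ_of_card
    rw [Finset.card_pair (Ne.symm hne), hcard]
  have hnorm : algebraMap ℚ K (Algebra.norm ℚ u) = u * τ u := by
    rw [Algebra.norm_eq_prod_automorphisms, huniv, Finset.prod_pair (Ne.symm hne), AlgEquiv.one_apply]
  -- read in `E`: `N_{K/ℚ}(u) = (x + ys)(x - ys) = x² + c₀y²`
  have hE : ((Algebra.norm ℚ u : ℚ) : cmField R) = ((x ^ 2 + c₀ * y ^ 2 : ℚ) : cmField R) := by
    have h2 := congrArg (algebraMap K (cmField R)) hnorm
    rw [map_mul, eq_ratCast (algebraMap ℚ K), map_ratCast, IntermediateField.algebraMap_apply,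
      IntermediateField.algebraMap_apply, hτ, hxy, map_add, map_mul, map_ratCast, map_ratCast, hsc] at h2
    rw [h2]
    push_cast
    linear_combination (-(y : cmField R) ^ 2) * hs
  refine ⟨x, y, ?_⟩
  rw [hnn]
  exact_mod_cast hE

/-- **The rational rows in closed form, uniformly: for `[F:ℚ] = deg R` ODD and `t ∈ F` with `σt² = −c₀`,
`c₀ ∈ ℚ_{>0}` (`E ∋ s = tη`, `s̄ = −s`, `s² = −c₀`: `E ⊇ ℚ(√−c₀)`), and every `q ∈ ℚ^×`:
`[q] = [(−1)²] = [1]` in `F^×/Nm_{E/F}(E^×)` iff `q = x² + c₀y²` for some `x, y ∈ ℚ`** (`⟸` part X-Z; `⟹`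
`q^{2m+1} = N_{E/ℚ}(z) = x² + c₀y²`, so `q = (x/q^m)² + c₀(y/q^m)²`). For the census: on every Weil-type table
over such an `E` the component `W.E.[q]` is the split one iff `q` is a norm from the imaginary quadratic subfield.
[cite: Deligne1982HodgeCycles, §4 p. 30 (1) and Cor. 4.2 (a)] -/
theorem mk_eq_splitDiscriminantClassCM_two_iff_of_odd (hodd : Odd R.natDegree) {c₀ : ℚ} (hc₀ : 0 < c₀)
    (t : realField R) (ht : AdjoinRoot.root (realPolyQ R) * t ^ 2 = AdjoinRoot.of (realPolyQ R) (-c₀))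
    {c : ℚ} (q : (realField R)ˣ) (hq : (q : realField R) = AdjoinRoot.of (realPolyQ R) c) :
    (QuotientGroup.mk q : cmNormResidueGroup R) = splitDiscriminantClassCM R 2 ↔
      ∃ x y : ℚ, c = x ^ 2 + c₀ * y ^ 2 := by
  refine ⟨fun h => ?_, fun ⟨x, y, hc⟩ => mk_eq_splitDiscriminantClassCM_two_of_sq_add_mul_sq t ht x y q (by rw [hq, hc])⟩
  have hc0 : c ≠ 0 := by
    rintro rfl
    rw [map_zero] at hq
    exact q.ne_zero hq
  rw [splitDiscriminantClassCM, neg_one_sq] at h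
  obtain ⟨z, -, hz⟩ := exists_eq_ratCast_mul_norm_of_mk_eq (q := q) (u := 1) (c := 1)
    (by rw [Units.val_one, Rat.cast_one]) h
  rw [Rat.cast_one, one_mul, hq, algebraMap_realField_eq, realToCM_of] at hz
  have hz' : z * cmConj R z = (c : cmField R) := by
    rw [← hz]
    exact eq_ratCast _ _
  -- the element `s = tη`
  set s : cmField R := realToCM R t * cmRoot R with hsdef
  have h3 : cmRoot R ^ 2 * realToCM R t ^ 2 = realToCM R (AdjoinRoot.of (realPolyQ R) (-c₀)) := by
    rw [← realToCM_root, ← map_pow, ← map_mul, ht]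
  have h4 : realToCM R (AdjoinRoot.of (realPolyQ R) (-c₀)) = -(c₀ : cmField R) := by
    rw [realToCM_of, eq_ratCast, Rat.cast_neg]
  have hs : s ^ 2 = -(c₀ : cmField R) := by
    rw [hsdef, mul_pow, mul_comm, h3, h4]
  have hsc : cmConj R s = -s := by
    rw [hsdef, map_mul, cmConj_realToCM, cmConj_cmRoot, mul_neg]
  obtain ⟨x, y, hxy⟩ := exists_norm_rat_eq_sq_add_mul_sq hc₀ s hs hsc z
  rw [norm_rat_eq_pow_of_mul_cmConj_eq z c hz'] at hxy
  obtain ⟨m, hm⟩ := hodd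
  rw [hm] at hxy
  refine ⟨x / c ^ m, y / c ^ m, ?_⟩
  have hcm : c ^ m ≠ 0 := pow_ne_zero m hc0
  symm
  calc (x / c ^ m) ^ 2 + c₀ * (y / c ^ m) ^ 2 = (x ^ 2 + c₀ * y ^ 2) / (c ^ m) ^ 2 := by
        field_simp
    _ = c ^ (2 * m + 1) / (c ^ m) ^ 2 := by rw [hxy]
    _ = c := (div_eq_iff (pow_ne_zero 2 hcm)).mpr (by ring)

end OddDegree

end Summit.HodgeConjecture.HodgeConjecture.Ring2.WeilCoverageCM

end
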